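import Summits.BirchSwinnertonDyer.BirchSwinnertonDyer.Theorems.ErratumRoadFiveNonSurjCornerKolyJSwapRowCornerPrime
import Summits.BirchSwinnertonDyer.BirchSwinnertonDyer.Theorems.ErratumRoadFiveNonSurjCornerMinusOneAtFive
import HarnessLib

/-!
# The (T4′) corner at `p = 5` WITHOUT the `−1` binder: the corner Čebotarev (McCallum Cor. 3.2 ∕ [J] Lemma 6.1 on the
# irreducible cell) and the swap supply's corollary, re-keyed on `E[5]` irreducible alone via
# `GaloisImage.exists_smul_eq_neg_five_of_irr` (cell `bsd-stepL`, seat `bsd-stepL-corner-p1` g8;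
# `--supports stmt-BirchSwinnertonDyer-19947`)

WHAT. Both kernel roads to `stub_kolyJ_max` on the (T4′) corner — the walk's Čebotarev input
(`Koly.exists_kolyvaginPrime_addOrderOf_localization_eq_shift_of_irr_of_neg`, p501512) and the swap supply
(`Koly.exists_deep_of_swapFamilies_of_irr_of_neg'`, p512423) — carried `hneg : −1 ∈ ρ̄_{E,p}(Γ_ℚ)`, to be discharged per
image type. At `p = 5` it is now a THEOREM for every irreducible `E[5]` (`…NonSurjCornerMinusOneAtFive`): this file records
the two `p = 5` specialisations with `hneg` gone — `exists_kolyvaginPrime_addOrderOf_localization_eq_shift_of_irr_five` and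
`exists_deep_of_swapFamilies_of_irr_five'`. At `p = 7` the binder stays (images without `−I` exist).
HONEST FRAMING: two theorems, no definition ∕ fact ∕ sorry; no stub closes; nothing about BSD (T7).
References (locators only): [cite: McCallumLMS1991, §3 Cor. 3.2, §5 Prop. 5.2] [cite: Jetchev2008, Lemma 5.1, Rem. 6.2 (p. 821)]
[cite: Serre1972, §2.4 Prop. 15, §2.6].
-/

set_option autoImplicit false

noncomputable section

open scoped Classical NumberField

namespace Summit.BirchSwinnertonDyer.Rank1Residual.X11b.Three.Koly

open WeierstrassCurve IsDedekindDomain NumberField Literature.NumberTheory.EllipticCurves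
  Literature.NumberTheory.EllipticCurves.ModularForms Literature.NumberTheory.EllipticCurves.Jetchev2008
  Literature.NumberTheory.GaloisRepresentations
  Literature.NumberTheory.GaloisRepresentations.DiscreteGaloisModule
  Summit.BirchSwinnertonDyer.Rank1Residual.JET Summit.BirchSwinnertonDyer.BirchSwinnertonDyer.Theorems
  Summit.BirchSwinnertonDyer.Rank1Residual

section Cebotarev

variable (W : WeierstrassCurve ℚ) [W.IsElliptic] [W.IsGloballyMinimal] [NeZero (W.conductorNorm ℤ)]
  {K : Type} [Field K] [NumberField K]

/-- **[J] Lemma 6.1 DECOUPLED at `p = 5` on the irreducible cell, NO `−1` binder** — p501512's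
`exists_kolyvaginPrime_addOrderOf_localization_eq_shift_of_irr_of_neg` with `hneg` discharged by
`GaloisImage.exists_smul_eq_neg_five_of_irr`: for `E[5]` irreducible, `K` imaginary quadratic with Gross's disjointness
prime `q ∣ d_K`, `q ∤ N_E`, `q ≠ 5`, `τ`-eigenclasses `x` (sign `e`) and `y ≠ 0` (sign `−e`) in `H¹(K, E[5^k])`, and any
bound: a Zhang–Kolyvagin prime `ℓ > b` of index `≥ k + j` preserving both orders.
[cite: Jetchev2008, Lemma 5.1 (p. 821), Rem. 6.2] [cite: McCallumLMS1991, §3 Cor. 3.2] [cite: Serre1972, §2.6] -/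
theorem exists_kolyvaginPrime_addOrderOf_localization_eq_shift_of_irr_five
    (hK : IsImaginaryQuadratic K) [Fact (Nat.Prime 5)] (hirr : W.HasIrreducibleModPGaloisRep 5)
    {q : ℕ} (hq : q.Prime) (hqd : (q : ℤ) ∣ NumberField.discr K) (hqN : ¬ q ∣ W.conductorNorm ℤ) (hqp : q ≠ 5)
    (τ : K ≃ₐ[ℚ] K) (hτ : τ ≠ 1) {k : ℕ} (hk : 1 ≤ k) (j : ℕ)
    {e : ℤ} (he : e = 1 ∨ e = -1)
    (x y : galH1Torsion (W.baseChange K) ((5 ^ k : ℕ) : ℤ))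
    (hx : conjAct W τ ((5 ^ k : ℕ) : ℤ) x = e • x) (hy : conjAct W τ ((5 ^ k : ℕ) : ℤ) y = (-e) • y)
    (hy0 : y ≠ 0) (b : ℕ) :
    ∃ ℓ : ℕ, b < ℓ ∧ Zhang2014.IsKolyvaginPrime (W.conductorNorm ℤ) W K 5 ℓ ∧
      k + j ≤ Zhang2014.kolyvaginIndex W 5 ℓ ∧
      ∀ v : HeightOneSpectrum (𝓞 K), (ℓ : 𝓞 K) ∈ v.asIdeal →
        addOrderOf (galoisCohomology.localization
            ((W.baseChange K).torsionGaloisModule ((5 ^ k : ℕ) : ℤ)) (Sum.inr v) 1 x) = addOrderOf x ∧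
        addOrderOf (galoisCohomology.localization
            ((W.baseChange K).torsionGaloisModule ((5 ^ k : ℕ) : ℤ)) (Sum.inr v) 1 y) = addOrderOf y :=
  exists_kolyvaginPrime_addOrderOf_localization_eq_shift_of_irr_of_neg W hK (by decide) hirr
    (GaloisImage.exists_smul_eq_neg_five_of_irr W hirr) hq hqd hqN hqp τ hτ hk j he x y hx hy hy0 b

end Cebotarev

/-- **The prime swap on the (T4′) CORNER row objects AT `p = 5` (`E[5]` irreducible, `ρ̄_{E,5}` not onto — item 19947, `stub_kolyJ_max`)** — the `−1`-input is FREE at `5` for GALOIS images: `det ρ̄_{E,5} = χ̄₅` is onto and the image has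
order prime to `5`, whence a central involution (`GaloisImage.exists_smul_eq_neg_five_of_irr`, `…NonSurjCornerMinusOneAtFive`);
so only Gross's disjointness prime `q ∣ d_K`, `q ∤ N_E`, `q ≠ 5` remains beside `hPT`, the pairing package and the `κ̄`
dictionary. [cite: McCallumLMS1991, §5 Prop. 5.2 (p. 304), §3 Cor. 3.2 (p. 299)] [cite: BurungaleEtAl2026, Prop. 2.2.1 (§2.2)]
[cite: Serre1972, §2.4 Prop. 15 and §2.6] -/
theorem exists_deep_of_swapFamilies_of_irr_five'
    (W : WeierstrassCurve ℚ) [W.IsElliptic] [W.IsGloballyMinimal] [NeZero (W.conductorNorm ℤ)]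
    (K : Type) [Field K] [NumberField K] (p : ℕ) [Fact p.Prime]
    (Dt : ModularParametrizationData W (W.conductorNorm ℤ)) (β : ℤ) (ι : K →+* ℂ)
    (hp5 : p = 5) (hK : IsImaginaryQuadratic K) (hirr : W.HasIrreducibleModPGaloisRep p)
    {q : ℕ} (hq : q.Prime) (hqd : (q : ℤ) ∣ NumberField.discr K) (hqN : ¬ q ∣ W.conductorNorm ℤ) (hqp : q ≠ p)
    (τ : K ≃ₐ[ℚ] K) (hτ : τ ≠ 1) (k i₀ e₀ : ℕ) (hk : 1 ≤ k)
    (𝒯 : SelmerStructure ((W.baseChange K).torsionGaloisModule ((p ^ k : ℕ) : ℤ)))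
    (D : ∀ s : {m : ℕ // Squarefree m ∧ ∀ q ∈ m.primeFactors,
        Zhang2014.IsKolyvaginPrime (W.conductorNorm ℤ) W K p q ∧ i₀ ≤ Zhang2014.kolyvaginIndex W p q},
      KolyvaginHeegnerData Dt β ι s.1)
    (eb : ℕ → Bool) (heb : ∀ (m ℓ : ℕ), ℓ.Prime → ¬ ℓ ∣ m → eb (m * ℓ) = !eb m)
    -- global duality count at a relaxed prime, per sign (the walk's `hPT`)
    (hPT : ∀ (s : {m : ℕ // Squarefree m ∧ ∀ q ∈ m.primeFactors,
        Zhang2014.IsKolyvaginPrime (W.conductorNorm ℤ) W K p q ∧ i₀ ≤ Zhang2014.kolyvaginIndex W p q})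
      (ℓ : ℕ), Zhang2014.IsKolyvaginPrime (W.conductorNorm ℤ) W K p ℓ →
      i₀ ≤ Zhang2014.kolyvaginIndex W p ℓ → ¬ ℓ ∣ s.1 →
      ∀ v : HeightOneSpectrum (𝓞 K), (ℓ : 𝓞 K) ∈ v.asIdeal → ∀ b : Bool,
      Nat.card ((signPart W K τ ((p ^ k : ℕ) : ℤ) (if b then 1 else -1)
          ((selmerF W ((p ^ k : ℕ) : ℤ) 𝒯 (placesDividing K s.1)).relaxedAt {v}).selmerGroup).map
        (galoisCohomology.localization ((W.baseChange K).torsionGaloisModule ((p ^ k : ℕ) : ℤ))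
          (Sum.inr v) 1)) = p ^ k)
    -- the level-`p` local Tate pairing package
    {Z : Type} [AddCommGroup Z]
    (pair : ∀ v : HeightOneSpectrum (𝓞 K),
      galoisCohomology (((W.baseChange K).torsionGaloisModule ((p ^ k : ℕ) : ℤ)).toLocal (Sum.inr v)) 1 →+
      galoisCohomology (((W.baseChange K).torsionGaloisModule ((p ^ k : ℕ) : ℤ)).toLocal (Sum.inr v)) 1 →+ Z)
    (hperf : ∀ (ℓ : ℕ), Zhang2014.IsKolyvaginPrime (W.conductorNorm ℤ) W K p ℓ →
      i₀ ≤ Zhang2014.kolyvaginIndex W p ℓ → ∀ v : HeightOneSpectrum (𝓞 K), (ℓ : 𝓞 K) ∈ v.asIdeal →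
      ∀ (e : ℤ), (e = 1 ∨ e = -1) →
      ∀ (x y : galoisCohomology ((W.baseChange K).torsionGaloisModule ((p ^ k : ℕ) : ℤ)) 1),
      conjAct W τ ((p ^ k : ℕ) : ℤ) x = e • x → conjAct W τ ((p ^ k : ℕ) : ℤ) y = e • y →
      galoisCohomology.localization ((W.baseChange K).torsionGaloisModule ((p ^ k : ℕ) : ℤ)) (Sum.inr v) 1 x ∈
        𝒯 (Sum.inr v) →
      galoisCohomology.localization ((W.baseChange K).torsionGaloisModule ((p ^ k : ℕ) : ℤ)) (Sum.inr v) 1 y ∈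
        (W.baseChange K).kummerSelmerStructure ((p ^ k : ℕ) : ℤ) (Sum.inr v) →
      galoisCohomology.localization ((W.baseChange K).torsionGaloisModule ((p ^ k : ℕ) : ℤ)) (Sum.inr v) 1 x ≠ 0 →
      galoisCohomology.localization ((W.baseChange K).torsionGaloisModule ((p ^ k : ℕ) : ℤ)) (Sum.inr v) 1 y ≠ 0 →
      pair v (galoisCohomology.localization ((W.baseChange K).torsionGaloisModule ((p ^ k : ℕ) : ℤ)) (Sum.inr v) 1 x)
        (galoisCohomology.localization ((W.baseChange K).torsionGaloisModule ((p ^ k : ℕ) : ℤ)) (Sum.inr v) 1 y) ≠ 0)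
    (hrec : ∀ (s : {m : ℕ // Squarefree m ∧ ∀ q ∈ m.primeFactors,
        Zhang2014.IsKolyvaginPrime (W.conductorNorm ℤ) W K p q ∧ i₀ ≤ Zhang2014.kolyvaginIndex W p q})
      (ℓ₀ ℓ : ℕ), Zhang2014.IsKolyvaginPrime (W.conductorNorm ℤ) W K p ℓ₀ → i₀ ≤ Zhang2014.kolyvaginIndex W p ℓ₀ →
      Zhang2014.IsKolyvaginPrime (W.conductorNorm ℤ) W K p ℓ → i₀ ≤ Zhang2014.kolyvaginIndex W p ℓ →
      ¬ ℓ₀ ∣ s.1 → ¬ ℓ ∣ s.1 → ℓ ≠ ℓ₀ →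
      ∀ v₀ : HeightOneSpectrum (𝓞 K), (ℓ₀ : 𝓞 K) ∈ v₀.asIdeal →
      ∀ v : HeightOneSpectrum (𝓞 K), (ℓ : 𝓞 K) ∈ v.asIdeal → ∀ (b : Bool)
      (a c : galoisCohomology ((W.baseChange K).torsionGaloisModule ((p ^ k : ℕ) : ℤ)) 1),
      a ∈ signPart W K τ ((p ^ k : ℕ) : ℤ) (if b then 1 else -1)
        ((selmerF W ((p ^ k : ℕ) : ℤ) 𝒯 (placesDividing K s.1)).relaxedAt {v₀}).selmerGroup →
      c ∈ signPart W K τ ((p ^ k : ℕ) : ℤ) (if b then 1 else -1)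
        (selmerF W ((p ^ k : ℕ) : ℤ) 𝒯 (placesDividing K (s.1 * ℓ₀ * ℓ))).selmerGroup →
      pair v₀ (galoisCohomology.localization ((W.baseChange K).torsionGaloisModule ((p ^ k : ℕ) : ℤ))
          (Sum.inr v₀) 1 c)
        (galoisCohomology.localization ((W.baseChange K).torsionGaloisModule ((p ^ k : ℕ) : ℤ))
          (Sum.inr v₀) 1 a) +
      pair v (galoisCohomology.localization ((W.baseChange K).torsionGaloisModule ((p ^ k : ℕ) : ℤ))
          (Sum.inr v) 1 c)
        (galoisCohomology.localization ((W.baseChange K).torsionGaloisModule ((p ^ k : ℕ) : ℤ))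
          (Sum.inr v) 1 a) = 0)
    -- the level-`p` classes `κ̄_n` and their dictionary
    (κb : {m : ℕ // Squarefree m ∧ ∀ q ∈ m.primeFactors,
        Zhang2014.IsKolyvaginPrime (W.conductorNorm ℤ) W K p q ∧ i₀ ≤ Zhang2014.kolyvaginIndex W p q} →
      galoisCohomology ((W.baseChange K).torsionGaloisModule ((p ^ k : ℕ) : ℤ)) 1)
    (hκSel : ∀ s, κb s ∈ signPart W K τ ((p ^ k : ℕ) : ℤ) (if eb s.1 then 1 else -1)
      (selmerF W ((p ^ k : ℕ) : ℤ) 𝒯 (placesDividing K s.1)).selmerGroup)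
    (h44c : ∀ (s s' : {m : ℕ // Squarefree m ∧ ∀ q ∈ m.primeFactors,
        Zhang2014.IsKolyvaginPrime (W.conductorNorm ℤ) W K p q ∧ i₀ ≤ Zhang2014.kolyvaginIndex W p q}) (ℓ : ℕ),
      Zhang2014.IsKolyvaginPrime (W.conductorNorm ℤ) W K p ℓ → i₀ ≤ Zhang2014.kolyvaginIndex W p ℓ →
      ¬ ℓ ∣ s.1 → s'.1 = s.1 * ℓ → ∀ v : HeightOneSpectrum (𝓞 K), (ℓ : 𝓞 K) ∈ v.asIdeal →
      (galoisCohomology.localization ((W.baseChange K).torsionGaloisModule ((p ^ k : ℕ) : ℤ)) (Sum.inr v) 1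
          (κb s') = 0 ↔
        galoisCohomology.localization ((W.baseChange K).torsionGaloisModule ((p ^ k : ℕ) : ℤ)) (Sum.inr v) 1
          (κb s) = 0))
    (hκ0 : ∀ s, κb s ≠ 0 ↔ ¬ PDiv (D s) p i₀)
    -- the start
    (c : ℕ) (hc : Squarefree c ∧ ∀ q ∈ c.primeFactors,
      Zhang2014.IsKolyvaginPrime (W.conductorNorm ℤ) W K p q ∧ i₀ ≤ Zhang2014.kolyvaginIndex W p q)
    (hc0 : ¬ PDiv (D ⟨c, hc⟩) p i₀) :
    ∃ s : {m : ℕ // Squarefree m ∧ ∀ q ∈ m.primeFactors,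
        Zhang2014.IsKolyvaginPrime (W.conductorNorm ℤ) W K p q ∧ i₀ ≤ Zhang2014.kolyvaginIndex W p q},
      (∀ q ∈ s.1.primeFactors, e₀ ≤ Zhang2014.kolyvaginIndex W p q) ∧ ¬ PDiv (D s) p i₀ := by
  subst hp5
  exact exists_deep_of_swapFamilies_of_irr_of_neg' W K 5 Dt β ι hK (by decide) hirr
    (GaloisImage.exists_smul_eq_neg_five_of_irr W hirr) hq hqd hqN hqp τ hτ k i₀ e₀ hk 𝒯 D eb heb
    hPT pair hperf hrec κb hκSel h44c hκ0 c hc hc0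


end Summit.BirchSwinnertonDyer.Rank1Residual.X11b.Three.Koly

end
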